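import Mathlib
import HarnessLib
import Summits.RiemannHypothesis.RiemannHypothesis.Theorems.IntegerScrewRungCertDefs

/-!
# Route `IntegerScrew` — kernel certificate checker for the finite rungs (2/3: series enclosures)

Soundness of the transcendental pieces of `IntegerScrewRungCertDefs.rungCheck` with respect to the tree's
fixed-point interval engine (`Literature.Analysis.ValidatedNumerics.Numerics.FI`): the prime sum
`Σ_{n ≤ m} Λ(n) n^{-1/2}(t − log n)` (`mem_primeSumEncl`), the geometric Hurwitz–Lerch series
`Φ(x) = Σ_k x^k/(k+¼)²` at `x = b²/a²` with its tail `≤ x^K/((K+¼)²(1 − x))` (`mem_lerchEncl`), the slope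
constant `A = γ₀ + π/2 + 3 log 2 + log π` (`mem_slopeEncl`; `γ₀` from
`Literature.Analysis.SpecialFunctions.EulerMascheroniBounds`, `π` and `log(1 − x)` from the engine), and the
rational lower bound `cLoQ ≤ C = ζ(2,¼)` by telescoping `(k+¼)^{-2} ≥ (k+¼)^{-1} − (k+5/4)^{-1}`
(`cLoQ_le_lerchC`). See part 1 for the design; nothing here bears on the truth of RH.
References: M. Suzuki, J. Lond. Math. Soc. (2) 108 (2023), (1.1) [Suzuki2023]; R. E. Moore, *Interval
Analysis* (1966) Ch. 2–4 [folklore].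
-/

set_option linter.dupNamespace false

namespace Summit.RiemannHypothesis.RiemannHypothesis.Theorems.IntegerScrew.RungCert

open Literature.NumberTheory.LFunctions Literature.Analysis.ValidatedNumerics
open Literature.Analysis.ValidatedNumerics.Numerics Finset
open scoped BigOperators

/-! ## The prime sum, the Hurwitz–Lerch series, the slope constant, the constant `C` -/

/-- One summand of the prime sum is enclosed. [folklore] -/
theorem mem_primeTerm {logs : List FI} {K : ℕ} (hL : ∀ n ≤ K, FI.mem (Real.log n) (lg logs n)) (hK : K ≤ 64) {t : ℝ} {T : FI}
    (ht : FI.mem t T) {n : ℕ} (hn1 : 1 ≤ n) (hn : n ≤ K) :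
    FI.mem ((ArithmeticFunction.vonMangoldt n : ℝ) / Real.sqrt n * (t - Real.log n))
      (primeTerm logs T n) := by
  have hlam : lamBase n ≤ K := (lamBase_le (hn.trans hK)).trans (max_le hn (hn1.trans hn))
  have h1 : FI.mem (Real.log (lamBase n)) (lg logs (lamBase n)) := hL _ hlam
  have h2 : FI.mem (Real.sqrt n / n) ((sqrtNat n).divNat n) := FI.mem_divNat (mem_sqrtNat n) hn1
  have h3 : FI.mem (t - Real.log n) (T.sub (lg logs n)) := FI.mem_sub ht (hL n hn)
  have h := FI.mem_mul (FI.mem_mul h1 h2) h3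
  rw [vonMangoldt_eq_log_lamBase (hn.trans hK)]
  have e : Real.log (lamBase n) / Real.sqrt n * (t - Real.log n) =
      Real.log (lamBase n) * (Real.sqrt n / n) * (t - Real.log n) := by
    rw [Real.sqrt_div_self']; ring
  rw [e]; exact h

/-- Invariant of `primeStep`. [folklore] -/
theorem primeStep_spec {logs : List FI} {K : ℕ} (hL : ∀ n ≤ K, FI.mem (Real.log n) (lg logs n)) (hK : K ≤ 64) {t : ℝ} {T : FI}
    (ht : FI.mem t T) : ∀ (m : ℕ) (acc : FI) (v : ℝ), FI.mem v acc → m ≤ K →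
    FI.mem (v + ∑ n ∈ Finset.Icc 1 m,
      (ArithmeticFunction.vonMangoldt n : ℝ) / Real.sqrt n * (t - Real.log n)) (primeStep logs T m acc)
  | 0, acc, v, hv, _ => by simpa [primeStep] using hv
  | m + 1, acc, v, hv, hm => by
    simp only [primeStep]
    have hterm := mem_primeTerm hL hK ht (n := m + 1) (by omega) hm
    have := primeStep_spec hL hK ht m _ _ (FI.mem_add hv hterm) (by omega)
    rw [Finset.sum_Icc_succ_top (by omega), add_comm (Finset.sum _ _) _, ← add_assoc]
    exact this

/-- **The prime sum is enclosed.** [folklore] -/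
theorem mem_primeSumEncl {logs : List FI} {K : ℕ} (hL : ∀ n ≤ K, FI.mem (Real.log n) (lg logs n)) (hK : K ≤ 64) {t : ℝ} {T : FI}
    (ht : FI.mem t T) {m : ℕ} (hm : m ≤ K) :
    FI.mem (∑ n ∈ Finset.Icc 1 m, (ArithmeticFunction.vonMangoldt n : ℝ) / Real.sqrt n * (t - Real.log n))
      (primeSumEncl logs T m) := by
  have := primeStep_spec hL hK ht m (FI.ofInt 0) 0 (by simpa using FI.mem_ofInt 0) hm
  simpa [primeSumEncl] using this

/-- The Hurwitz–Lerch term `x^k/(k+¼)² = 16 x^k/(4k+1)²` is enclosed. [folklore] -/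
theorem mem_lerchTerm {x : ℝ} {pw : FI} {k : ℕ} (hp : FI.mem (x ^ k) pw) :
    FI.mem (x ^ k / ((k : ℝ) + 1 / 4) ^ 2) ((pw.mulInt 16).divNat ((4 * k + 1) ^ 2)) := by
  have h := FI.mem_divNat (FI.mem_mulInt hp 16) (n := (4 * k + 1) ^ 2) (by positivity)
  convert h using 1
  push_cast
  field_simp
  ring

/-- Invariant of `lerchGo`: the state `(k, pw, s)` satisfies `x^k ∈ pw`, `Σ_{j<k} x^j/(j+¼)² ∈ s`. [folklore] -/
theorem lerchGo_spec {x : ℝ} {X : FI} (hx : FI.mem x X) (xn xd : ℕ) :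
    ∀ (fuel k : ℕ) (pw s : FI), FI.mem (x ^ k) pw →
      FI.mem (∑ j ∈ range k, x ^ j / ((j : ℝ) + 1 / 4) ^ 2) s →
      FI.mem (x ^ (lerchGo X xn xd fuel k pw s).1) (lerchGo X xn xd fuel k pw s).2.1 ∧
        FI.mem (∑ j ∈ range (lerchGo X xn xd fuel k pw s).1, x ^ j / ((j : ℝ) + 1 / 4) ^ 2)
          (lerchGo X xn xd fuel k pw s).2.2
  | 0, k, pw, s, hp, hs => by simpa [lerchGo] using And.intro hp hs
  | fuel + 1, k, pw, s, hp, hs => by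
    simp only [lerchGo]
    split_ifs with h
    · exact ⟨hp, hs⟩
    · refine lerchGo_spec hx xn xd fuel (k + 1) _ _ ?_ ?_
      · rw [pow_succ]; exact FI.mem_mul hp hx
      · rw [Finset.sum_range_succ]; exact FI.mem_add hs (mem_lerchTerm hp)

/-- Summability of `x^j/(j+¼)²`, `0 ≤ x ≤ 1`. [folklore] -/
theorem summable_lerch {x : ℝ} (hx0 : 0 ≤ x) (hx1 : x ≤ 1) :
    Summable fun j : ℕ => x ^ j / ((j : ℝ) + 1 / 4) ^ 2 := by
  refine summable_one_div_nat_add_quarter_sq.of_nonneg_of_le (fun k => by positivity) fun k => ?_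
  exact div_le_div_of_nonneg_right (pow_le_one₀ hx0 hx1) (by positivity)

/-- Geometric bound of the tail: `Σ_{j≥K} x^j/(j+¼)² ≤ x^K/((K+¼)²(1−x))`. [folklore] -/
theorem lerch_tail_le {x : ℝ} (hx0 : 0 ≤ x) (hx1 : x < 1) (K : ℕ) :
    ∑' i : ℕ, x ^ (i + K) / (((i + K : ℕ) : ℝ) + 1 / 4) ^ 2 ≤ x ^ K / (((K : ℝ) + 1 / 4) ^ 2 * (1 - x)) := by
  have hs := summable_lerch hx0 hx1.le
  have hgeom : Summable fun i : ℕ => x ^ K / ((K : ℝ) + 1 / 4) ^ 2 * x ^ i :=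
    (summable_geometric_of_lt_one hx0 hx1).mul_left _
  have hterm : ∀ i : ℕ, x ^ (i + K) / (((i + K : ℕ) : ℝ) + 1 / 4) ^ 2
      ≤ x ^ K / ((K : ℝ) + 1 / 4) ^ 2 * x ^ i := by
    intro i
    have hi : (0 : ℝ) ≤ i := Nat.cast_nonneg i
    have hDK : (0 : ℝ) < ((K : ℝ) + 1 / 4) ^ 2 := by positivity
    have hinv : (((i : ℝ) + K + 1 / 4) ^ 2)⁻¹ ≤ (((K : ℝ) + 1 / 4) ^ 2)⁻¹ :=
      inv_anti₀ hDK (pow_le_pow_left₀ (by positivity) (by linarith) 2)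
    calc x ^ (i + K) / (((i + K : ℕ) : ℝ) + 1 / 4) ^ 2
        = x ^ K * x ^ i * (((i : ℝ) + K + 1 / 4) ^ 2)⁻¹ := by
          push_cast; rw [pow_add, div_eq_mul_inv]; ring
      _ ≤ x ^ K * x ^ i * (((K : ℝ) + 1 / 4) ^ 2)⁻¹ :=
          mul_le_mul_of_nonneg_left hinv (by positivity)
      _ = x ^ K / ((K : ℝ) + 1 / 4) ^ 2 * x ^ i := by rw [div_eq_mul_inv]; ring
  calc ∑' i : ℕ, x ^ (i + K) / (((i + K : ℕ) : ℝ) + 1 / 4) ^ 2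
      ≤ ∑' i : ℕ, x ^ K / ((K : ℝ) + 1 / 4) ^ 2 * x ^ i :=
        Summable.tsum_le_tsum hterm ((summable_nat_add_iff K).mpr hs) hgeom
    _ = x ^ K / ((K : ℝ) + 1 / 4) ^ 2 * ∑' i : ℕ, x ^ i := tsum_mul_left
    _ = x ^ K / (((K : ℝ) + 1 / 4) ^ 2 * (1 - x)) := by
        rw [tsum_geometric_of_lt_one hx0 hx1]; field_simp

/-- The tail bound is enclosed by `lerchTail`. [folklore] -/
theorem tail_le_lerchTail {xn xd : ℕ} (hlt : xn < xd) {k : ℕ} {pw : FI}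
    (hp : FI.mem (((xn : ℝ) / xd) ^ k) pw) :
    (∑' i : ℕ, ((xn : ℝ) / xd) ^ (i + k) / (((i + k : ℕ) : ℝ) + 1 / 4) ^ 2) * SC ≤
      ((lerchTail xn xd k pw).hi : ℝ) := by
  set x : ℝ := (xn : ℝ) / xd with hxdef
  have hxd : (0 : ℝ) < xd := by exact_mod_cast (show 0 < xd by omega)
  have hx0 : 0 ≤ x := by positivity
  have hx1 : x < 1 := by rw [hxdef, div_lt_one hxd]; exact_mod_cast hlt
  have htail := lerch_tail_le hx0 hx1 k
  have hsub : 0 < xd - xn := by omega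
  have hm := FI.mem_divNat (FI.mem_mulInt hp ((16 * xd : ℕ) : ℤ)) (n := (4 * k + 1) ^ 2 * (xd - xn))
    (by positivity)
  have heq : x ^ k * (((16 * xd : ℕ) : ℤ) : ℝ) / (((4 * k + 1) ^ 2 * (xd - xn) : ℕ) : ℝ) =
      x ^ k / (((k : ℝ) + 1 / 4) ^ 2 * (1 - x)) := by
    have h1 : (((xd - xn : ℕ)) : ℝ) = (xd : ℝ) - xn := by push_cast [Nat.cast_sub hlt.le]; ring
    push_cast
    rw [h1, hxdef]
    field_simp
    ring
  rw [heq] at hm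
  exact le_trans (mul_le_mul_of_nonneg_right htail SC_pos.le) hm.2

/-- **The Hurwitz–Lerch value is enclosed**: `Σ_k (b²/a²)^k/(k+¼)² ∈ lerchEncl a b` (`b < a`). [folklore] -/
theorem mem_lerchEncl {a b : ℕ} (hab : b < a) :
    FI.mem (∑' k : ℕ, (((b * b : ℕ) : ℝ) / ((a * a : ℕ) : ℝ)) ^ k / ((k : ℝ) + 1 / 4) ^ 2)
      (lerchEncl a b) := by
  have ha : 0 < a := by omega
  have hlt : b * b < a * a := Nat.mul_self_lt_mul_self hab
  set x : ℝ := ((b * b : ℕ) : ℝ) / ((a * a : ℕ) : ℝ) with hxdef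
  have hxd : (0 : ℝ) < ((a * a : ℕ) : ℝ) := by exact_mod_cast Nat.mul_pos ha ha
  have hx0 : 0 ≤ x := by positivity
  have hx1 : x < 1 := by rw [hxdef, div_lt_one hxd]; exact_mod_cast hlt
  have hX : FI.mem x (FI.ofFrac (b * b : ℕ) (a * a)) := by
    have := FI.mem_ofFrac ((b * b : ℕ) : ℤ) (q := a * a) (Nat.mul_pos ha ha)
    simpa [hxdef] using this
  have h0 : FI.mem (x ^ 0) (FI.ofInt 1) := by simpa using FI.mem_ofInt 1
  have h0' : FI.mem (∑ j ∈ range 0, x ^ j / ((j : ℝ) + 1 / 4) ^ 2) (FI.ofInt 0) := by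
    simpa using FI.mem_ofInt 0
  obtain ⟨hp, hs⟩ := lerchGo_spec hX (b * b) (a * a) lerchFuel 0 _ _ h0 h0'
  set r := lerchGo (FI.ofFrac (b * b : ℕ) (a * a)) (b * b) (a * a) lerchFuel 0 (FI.ofInt 1) (FI.ofInt 0)
    with hr
  have hsum := summable_lerch hx0 hx1.le
  have hsplit := (hsum.sum_add_tsum_nat_add r.1).symm
  simp only [lerchEncl]
  rw [← hr, hsplit]
  refine FI.mem_add hs ⟨?_, ?_⟩
  · push_cast
    exact mul_nonneg (tsum_nonneg fun i => by positivity) SC_pos.le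
  · have := tail_le_lerchTail hlt (k := r.1) (pw := r.2.1) (by simpa [hxdef] using hp)
    simpa [hxdef] using this

/-- **The slope constant is enclosed**: `A = γ₀ + π/2 + 3 log 2 + log π ∈ slopeEncl logs`. [folklore] -/
theorem mem_slopeEncl {logs : List FI} {K : ℕ} (hL : ∀ n ≤ K, FI.mem (Real.log n) (lg logs n)) (hK : 2 ≤ K) {A : FI}
    (h : slopeEncl logs = some A) :
    FI.mem (Real.eulerMascheroniConstant + Real.pi / 2 + 3 * Real.log 2 + Real.log Real.pi) A := by
  unfold slopeEncl at h
  split at h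
  · exact absurd h (by simp)
  · rename_i l hl
    simp only [Option.some.injEq] at h
    subst h
    have hy : FI.mem (1 - Real.pi / 4) ((FI.ofInt 1).sub (FI.pi.divNat 4)) := by
      have := FI.mem_sub (FI.mem_ofInt 1) (FI.mem_divNat FI.mem_pi (n := 4) (by norm_num))
      simpa using this
    have hlog := FI.mem_logOneSub hl hy
    have hγ : FI.mem Real.eulerMascheroniConstant
        (FI.ofRatRat (57721558 / 100000000) (57721571 / 100000000)) := by
      refine FI.mem_ofRatRat ?_ ?_
      · have := Literature.Analysis.SpecialFunctions.Real.eulerMascheroniConstant_gt_d8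
        push_cast; linarith
      · have := Literature.Analysis.SpecialFunctions.Real.eulerMascheroniConstant_lt_d8
        push_cast; linarith
    have h2 : FI.mem (Real.log 2) (lg logs 2) := by simpa using hL 2 hK
    have hpi : Real.log Real.pi = Real.log 2 * (2 : ℤ) + Real.log (1 - (1 - Real.pi / 4)) := by
      rw [sub_sub_cancel, Real.log_div Real.pi_pos.ne' (by norm_num),
        show (4 : ℝ) = 2 ^ 2 by norm_num, Real.log_pow]
      push_cast; ring
    have := FI.mem_add (FI.mem_add (FI.mem_add hγ (FI.mem_divNat FI.mem_pi (n := 2) (by norm_num)))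
      (FI.mem_mulInt h2 3)) (FI.mem_add (FI.mem_mulInt h2 2) hlog)
    rw [← hpi] at this
    convert this using 1
    push_cast; ring

/-- Invariant of `cPartial`: `Σ_{k<K} (k+¼)^{-2} ∈ cPartial K`. [folklore] -/
theorem mem_cPartial : ∀ K : ℕ, FI.mem (∑ k ∈ range K, 1 / ((k : ℝ) + 1 / 4) ^ 2) (cPartial K)
  | 0 => by simpa [cPartial] using FI.mem_ofInt 0
  | K + 1 => by
    rw [Finset.sum_range_succ, cPartial]
    refine FI.mem_add (mem_cPartial K) ?_
    have := FI.mem_ofFrac 16 (q := (4 * K + 1) ^ 2) (by positivity)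
    convert this using 1
    push_cast; field_simp; ring

/-- Telescoping lower bound of the tail: `Σ_{K ≤ k < K'} (k+¼)^{-2} ≥ 1/(K+¼) − 1/(K'+¼)`. [folklore] -/
theorem sum_Ico_quarter_sq_ge (K : ℕ) : ∀ K' : ℕ, K ≤ K' →
    1 / ((K : ℝ) + 1 / 4) - 1 / ((K' : ℝ) + 1 / 4) ≤ ∑ k ∈ Finset.Ico K K', 1 / ((k : ℝ) + 1 / 4) ^ 2
  | 0, h => by simp [Nat.le_zero.1 h]
  | K' + 1, h => by
    rcases Nat.lt_or_ge K (K' + 1) with hlt | hge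
    · rw [Finset.sum_Ico_succ_top (by omega)]
      have ih := sum_Ico_quarter_sq_ge K K' (by omega)
      have hK' : (0 : ℝ) ≤ K' := Nat.cast_nonneg K'
      have hstep : 1 / ((K' : ℝ) + 1 / 4) - 1 / (((K' + 1 : ℕ) : ℝ) + 1 / 4) ≤
          1 / ((K' : ℝ) + 1 / 4) ^ 2 := by
        push_cast
        rw [div_sub_div _ _ (by positivity) (by positivity), div_le_div_iff₀ (by positivity) (by positivity)]
        nlinarith
      push_cast at hstep ⊢
      linarith
    · have : K = K' + 1 := le_antisymm h hge
      subst this; simp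

/-- **Lower bound of `C = ζ(2,¼)`**: `Σ_{k<K} (k+¼)^{-2} + 1/(K+¼) ≤ C`. [folklore] -/
theorem partial_add_inv_le_lerchC (K : ℕ) :
    ∑ k ∈ range K, 1 / ((k : ℝ) + 1 / 4) ^ 2 + 1 / ((K : ℝ) + 1 / 4) ≤
      ∑' k : ℕ, 1 / ((k : ℝ) + 1 / 4) ^ 2 := by
  have hs := summable_one_div_nat_add_quarter_sq
  refine le_of_forall_pos_lt_add fun ε hε => ?_
  -- choose K' with 1/(K'+¼) < ε
  obtain ⟨K', hK'⟩ := exists_nat_gt (1 / ε)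
  have hK'pos : (0 : ℝ) < (K' : ℝ) + 1 / 4 := by positivity
  have hsmall : 1 / ((max K K' : ℕ) + 1 / 4 : ℝ) < ε := by
    rw [div_lt_iff₀ (by positivity)]
    have : (K' : ℝ) ≤ ((max K K' : ℕ) : ℝ) := by exact_mod_cast le_max_right K K'
    have h1 : 1 < ε * K' := by rwa [div_lt_iff₀ hε, mul_comm] at hK'
    nlinarith
  have htele := sum_Ico_quarter_sq_ge K (max K K') (le_max_left _ _)
  have hsplit : ∑ k ∈ range (max K K'), 1 / ((k : ℝ) + 1 / 4) ^ 2 =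
      ∑ k ∈ range K, 1 / ((k : ℝ) + 1 / 4) ^ 2 + ∑ k ∈ Finset.Ico K (max K K'), 1 / ((k : ℝ) + 1 / 4) ^ 2 := by
    rw [Finset.range_eq_Ico, Finset.range_eq_Ico,
      ← Finset.sum_Ico_consecutive _ (Nat.zero_le K) (le_max_left K K')]
  have hle : ∑ k ∈ range (max K K'), 1 / ((k : ℝ) + 1 / 4) ^ 2 ≤ ∑' k : ℕ, 1 / ((k : ℝ) + 1 / 4) ^ 2 :=
    hs.sum_le_tsum _ fun k _ => by positivity
  linarith

/-- **`cLoQ ≤ C`.** [folklore] -/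
theorem cLoQ_le_lerchC : ((cLoQ : ℚ) : ℝ) ≤ ∑' k : ℕ, 1 / ((k : ℝ) + 1 / 4) ^ 2 := by
  have h1 := (mem_cPartial cTerms).1
  have h2 := partial_add_inv_le_lerchC cTerms
  have hS := SC_pos
  have h3 : (((cPartial cTerms).lo : ℤ) : ℝ) / SC ≤ ∑ k ∈ range cTerms, 1 / ((k : ℝ) + 1 / 4) ^ 2 := by
    rw [div_le_iff₀ hS]; exact h1
  have h4 : ((cLoQ : ℚ) : ℝ) = (((cPartial cTerms).lo : ℤ) : ℝ) / SC + 4 / (4 * (cTerms : ℝ) + 1) := by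
    unfold cLoQ; push_cast; ring
  have h5 : (4 : ℝ) / (4 * (cTerms : ℝ) + 1) = 1 / ((cTerms : ℝ) + 1 / 4) := by
    rw [div_eq_div_iff (by positivity) (by positivity)]; ring
  rw [h4, h5]
  linarith

end Summit.RiemannHypothesis.RiemannHypothesis.Theorems.IntegerScrew.RungCert
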